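import Literature.Analysis.FluidPDE.RusinSverakWeakLimitBlowupFourLeaves
import Literature.Analysis.FluidPDE.LocalEnergyExtensionHolds
import Literature.Analysis.FluidPDE.LocalLerayWeakStrongUniquenessHolds
import Literature.Analysis.FluidPDE.JiaSverak2013Lemma8Holds
import Literature.Analysis.FluidPDE.LocalLerayLimitIdentification
import HarnessLib

/-!
# Discharge of Rusin–Šverák's Thm. 4.1 (`leray_solution_ae_eq_kato`, **W**)

Analysis/FluidPDE theorem file (no definitions, no named facts). The accepted review file
`RusinSverakWeakLimitBlowupFourLeaves.lean` records the four Leray-theory inputs **E**, **W**,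
**R**, **S** of Rusin–Šverák's Cor. 4.2 jointly over the four leaves **F2**
`localEnergySolution_extension_of_memE2`, **U** `local_leray_weak_strong_uniqueness`, **J8**
`jia_sverak_2013_lemma_8`, **Lim** `localLeray_limit_isLocalLeraySolution`
(`leray_theory_inputs_of_four_leaves`). All four leaves are discharged in the tree
(`localEnergySolution_extension_of_memE2_holds`, `local_leray_weak_strong_uniqueness_holds`,
`jia_sverak_2013_lemma_8_holds`, `localLeray_limit_isLocalLeraySolution_holds`), and so are, since
2026-08-16, Cor. 4.2, Cor. 4.3 and the weak-limit blow-up (`RusinSverakCompactnessHolds.lean`) and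
**S** (`RusinSverakSingularPointsStableHolds.lean`). This file discharges the one remaining member,
**W** = Rusin–Šverák's Thm. 4.1 (W. Rusin, V. Šverák, *Minimal initial data for potential
Navier–Stokes singularities*, J. Funct. Anal. 260 (2011) = arXiv:0911.0500, Thm. 4.1, p. 6: a local
Leray solution with `L³` datum agrees a.e. with the Kato solution on the latter's interval of
existence; named fact `leray_solution_ae_eq_kato`, `RusinSverakLeraySolutions.lean`).

## Mathlib / tree search

Tree (used): `leray_theory_inputs_of_four_leaves` and the four leaf discharges.
`lean search 'leray_solution_ae_eq_kato_holds'`: nothing (2026-08-16).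

## References

* W. Rusin, V. Šverák, J. Funct. Anal. 260 (2011) 879–891 = arXiv:0911.0500, Thm. 4.1 (p. 6).
  [RusinSverak2011]
* P. G. Lemarié-Rieusset, *The Navier–Stokes Problem in the 21st Century*, CRC Press 2016,
  Thm. 14.7, Thm. 15.1. [LemarieRieusset2016]
-/

noncomputable section

namespace Literature.Analysis.FluidPDE

/-- **Rusin–Šverák, Thm. 4.1** (`leray_solution_ae_eq_kato`, **W**): a local Leray solution
with `L³` datum agrees a.e. with the Kato solution on the latter's interval of existence — the
second component of `leray_theory_inputs_of_four_leaves` at the four leaf discharges (in print: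
weak–strong uniqueness for local Leray solutions, Lemarié-Rieusset Thm. 14.7, with the local Leray
property of Kato solutions, Thm. 15.1). [cite: RusinSverak2011, Thm. 4.1 (arXiv:0911.0500 p. 6)]
[cite: LemarieRieusset2016, Thm. 14.7 and Thm. 15.1] -/
theorem leray_solution_ae_eq_kato_holds : leray_solution_ae_eq_kato :=
  (leray_theory_inputs_of_four_leaves
    localEnergySolution_extension_of_memE2_holds local_leray_weak_strong_uniqueness_holds
    jia_sverak_2013_lemma_8_holds localLeray_limit_isLocalLeraySolution_holds).2.1

end Literature.Analysis.FluidPDE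

end
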